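import Literature.MathematicalPhysics.QuantumFieldTheory.Federbush1986.NonAbelianDualityTheorem1

/-!
# `Federbush1986.NonAbelianDualityPlaquetteBCH` — [Federbush1987PhaseCellVI] Theorem 2 p. 20, the NON-ABELIAN PLAQUETTE
# ALGEBRA: `|e^{a₁}e^{a₂}e^{−a₃}e^{−a₄}| = |a₁ + a₂ − a₃ − a₄ + ½([a₁,a₂] + [a₃,a₄] − [a₁+a₂, a₃+a₄])| + O(|a|³)` under the
# uniform second-order Baker–Campbell–Hausdorff binder of typing note T-F6-2; theorems only

statement-level skeleton of published theorems with citation tags; proofs where landed; nothing here is a claim about the Yang–Mills mass gap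

CITATION HEADER.  P. Federbush, *A phase cell approach to Yang–Mills theory. VI. Non-abelian lattice-continuum duality*,
Ann. Inst. H. Poincaré (Physique théorique) **47** (1987) 17–23, Numdam `AIHPA_1987__47_1_17_0` [Federbush1987PhaseCellVI]
(cell paper F6; PDF held locally `run/shared/lean/pub/pub-balaban/t4/b2b-balaban-t4-lit2/pdf/fed1987-aihp47-VI.pdf`; pp. 18–20,
23 READ AS IMAGES `run/shared/lean/pub/lit-balaban/lit-balaban-r19/renders/fedVI/fedVI-p003.png`, `-p005.png`, `-p008.png`;
journal page = PDF page + 15 in that set).  P. Federbush, *… III. Local stability, modified renormalization group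
transformation*, Commun. Math. Phys. **110** (1987) 293–309 [Federbush1987PhaseCellIII], Lemma 1.1 (1.4)–(1.9) p. 295 (BCH),
§3 (3.1)–(3.2) p. 296–297 (`g_{∂P} = e^{A_{∂P}}`).  Unit `lit-balaban-r19` gen 5 (reader/typer r19; owner of the F6 statement
file); SKELETON rows **F6.Thm2** / **F6.Eq10** (statement of record `BlockSpinSystem.Theorem2Oriented` / `latticeActionOriented`,
`Federbush1986/NonAbelianDuality.lean` v5 = p249539) of `run/shared/lean/pub/lit-balaban/lit-balaban-r17/SKELETON-r17.md`.
Companion of `PlaquetteStokes` / `LatticeRiemannSums` (unit `lit-balaban-r17` gen 3: the ABELIAN part of «lattice action →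
continuum action»); this module is the piece those files leave «to T-F6-2»: the commutator term.  HOME
`run/shared/lean/pub/lit-balaban/` (TAKING line HOME/STATUS.md 2026-08-21T05:13:41Z).

WHAT IS PRINTED.  VI p. 18: «The lattice actions likewise approach the continuum action ½∫(dA + A ∧ A)²»; (10) p. 20
«S^r_0 = ¼ Σ_p |g_{∂p}|²»; (5)–(6) p. 19 «If u(g) = e^A with A « small » we may set d²(Id, g) = −Tr A² … |g| = d(Id, g)»;
Theorem 2 p. 20; p. 23 «We will not detail the proof of Theorem 2.»  III p. 295 (1.6)–(1.9): the invariant distance and the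
Baker–Campbell–Hausdorff expansion of `e^{−A}e^{B}` to second order.

THE BINDER (T-F6-2, second part; owner ruling HOME/STATUS.md 2026-08-21T05:08:18Z, as for T-F6-1: an explicit hypothesis of
the proof theorems, no new field of `IsFederbushSystem`, no new `Prop`).  The carrier ties the bracket `lie` to `exp` only
INFINITESIMALLY and pointwise (`IsFederbushSystem.lie_commutator`: `d(e^{tA}e^{tB}e^{−tA}e^{−tB}, e^{t²[A,B]}) = o(t²)`); the
plaquette expansion needs the second-order BCH comparison UNIFORMLY on a ball:
`hBCH : ∃ ρ > 0, ∃ C, ∀ X Y, ‖X‖ < ρ → ‖Y‖ < ρ → dist (e^X e^Y) (e^{X + Y + ½[X,Y]}) ≤ C (‖X‖ + ‖Y‖)³`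
(true for the exponential map of a compact matrix group with a bi-invariant Riemannian distance).

THE MATHEMATICS.  (§1) From the one-parameter property `exp_line`: `e^0 = Id`, `e^{−A} = (e^A)⁻¹`; from `lie_commutator` at
`B = A` (the group commutator of `e^{tA}` with itself is `Id`) and `|e^X| = |X|` near `0` (`exp_norm`): `[A, A] = 0` — the
bracket vanishes on the diagonal, DERIVED from the carrier; `lie` is a bounded bilinear map (`𝔤` is finite-dimensional).
(§2) For `a₁, …, a₄` in a small ball, with `Y₁ = a₁ + a₂ + ½[a₁,a₂]`, `Y₂ = −a₃ − a₄ + ½[a₃,a₄]`: by `hBCH` twice and the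
bi-invariance of the distance (`dist_mul_mul_le`), `d(e^{a₁}e^{a₂}e^{−a₃}e^{−a₄}, e^{Y₁}e^{Y₂}) ≤ C((|a₁|+|a₂|)³ + (|a₃|+|a₄|)³)`,
then `hBCH` once more: `d(e^{Y₁}e^{Y₂}, e^{Z}) ≤ C(|Y₁|+|Y₂|)³`, `Z = Y₁ + Y₂ + ½[Y₁,Y₂] = P + Q + R` with the abelian
plaquette value `P = a₁ + a₂ − a₃ − a₄`, the commutator term `Q = ½([a₁,a₂] + [a₃,a₄] − [a₁+a₂, a₃+a₄])` and the remainder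
`R = ¼[a₁+a₂, [a₃,a₄]] − ¼[[a₁,a₂], a₃+a₄] + ⅛[[a₁,a₂],[a₃,a₄]]`, `|R| ≤ L²|a|³`; finally `|g| = d(Id, g)`,
`|d(Id, g) − d(Id, e^Z)| ≤ d(g, e^Z)` and `d(Id, e^Z) = |Z|` (`exp_norm`).  (§3) On a plaquette of side `ℓ` of a configuration
`a_i = ℓ α_i + δ_i`, `α = (U, V, U, V)` (the potential at the base point in the two directions), `|δ_i| ≤ Dℓ²` (the edge
corrections of the cascade): `Q = ℓ²[U, V] + O(ℓ³)` by bilinearity and `[X, X] = 0`, so `|g_{∂p}| = |P + ℓ²[U,V]| + O(ℓ³)` —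
the commutator `[A_μ, A_ν]` of the continuum density `contActionDensity`.

WHAT THIS MODULE PROVES (theorems only; no `def`, no `Prop` definition, no named fact; axioms standard).  §1 `exp_zero`,
`exp_neg`, `plaqWord_eq` (`u₁u₂u₃⁻¹u₄⁻¹ = (e^{a₁}e^{a₂})(e^{−a₃}e^{−a₄})`), **`lie_self`** (`S.lie A A = 0`), `lie_neg_neg`,
`exists_lie_bound` (`∃ L ≥ 0, |[X,Y]| ≤ L|X||Y|`); §2 `abs_absG_sub_absG_le` (`||g| − |h|| ≤ d(g,h)`), `bch_combine` (the
identity `Z = P + Q + R` for any bilinear bracket), `norm_lie_le_of_le`, `norm_bchRem_le` (`|R| ≤ L²s³`),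
`absG_plaqWord_expansion_core` (the estimate with the smallness of `s = Σ|a_i|` explicit, constant `10C₀ + L²`) and
**`absG_plaqWord_expansion`** (the displayed `O(|a|³)` expansion: `∃ ρ₁ > 0, ∃ K ≥ 0, …`); §3 `commutatorTerm_affine_eq`
(algebra), `norm_commutatorTerm_affine_sub_le` (`|Q − ℓ²[U,V]| ≤ L(6BD + 3D²)ℓ³`) and **`absG_plaqWord_expansion_affine`**
(the `O(ℓ³)` form for `a_i = ℓα_i + δ_i`: `| |g_{∂p}| − |P + ℓ²[U,V]| | ≤ (64K(B+D)³ + L(6BD+3D²))ℓ³`).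
-/

namespace Literature.MathematicalPhysics.QuantumFieldTheory.Federbush1986

noncomputable section

open Filter Metric
open scoped Topology

namespace BlockSpinSystem

variable (S : BlockSpinSystem)

/-! ## §1 Consequences of the carrier: `e^0 = Id`, `e^{−A} = (e^A)⁻¹`, `[A, A] = 0`, boundedness of the bracket -/

/-- `e^0 = Id` (one-parameter property «g = e^A», `exp_line`). [cite: Federbush1987PhaseCellVI, (5)–(6) p. 19] -/
theorem exp_zero (hFS : S.IsFederbushSystem) : S.exp 0 = 1 := by
  have h := S.exp_zero_smul hFS 0
  rwa [smul_zero] at h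

/-- `e^{−A} = (e^A)⁻¹` (from `e^{(1 + (−1))A} = e^{A}e^{−A}`). [cite: Federbush1987PhaseCellVI, (5)–(6) p. 19;
Federbush1987PhaseCellIII, (1.6) p. 295] -/
theorem exp_neg (hFS : S.IsFederbushSystem) (A : S.𝔤) : S.exp (-A) = (S.exp A)⁻¹ := by
  have h := hFS.exp_line A 1 (-1)
  rw [add_neg_cancel, one_smul, neg_one_smul, S.exp_zero_smul hFS] at h
  exact eq_inv_of_mul_eq_one_right h.symm

/-- The plaquette word of exponentials: `e^{a₁}e^{a₂}(e^{a₃})⁻¹(e^{a₄})⁻¹ = (e^{a₁}e^{a₂})·(e^{−a₃}e^{−a₄})` (the edge order of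
`plaqHol`; III p. 297 «g_{∂P} may be understood as g₁g₂g₃g₄»). [cite: Federbush1987PhaseCellVI, (10) p. 20;
Federbush1987PhaseCellIII, (3.1)–(3.2) p. 296–297] -/
theorem plaqWord_eq (hFS : S.IsFederbushSystem) (a₁ a₂ a₃ a₄ : S.𝔤) :
    S.exp a₁ * S.exp a₂ * (S.exp a₃)⁻¹ * (S.exp a₄)⁻¹ = (S.exp a₁ * S.exp a₂) * (S.exp (-a₃) * S.exp (-a₄)) := by
  rw [S.exp_neg hFS, S.exp_neg hFS, mul_assoc]

/-- **`[A, A] = 0`, derived from the carrier.**  The group commutator of `e^{tA}` with itself is `Id`, so `lie_commutator` at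
`B = A` says `t⁻²·d(Id, e^{t²[A,A]}) → 0`; by `exp_norm` this quantity equals `|[A,A]|` for small `t ≠ 0`.
[cite: Federbush1987PhaseCellVI, (5)–(6) p. 19; Federbush1987PhaseCellIII, (1.8)–(1.9) p. 295] -/
theorem lie_self (hFS : S.IsFederbushSystem) (A : S.𝔤) : S.lie A A = 0 := by
  obtain ⟨ρ, hρ, hnorm⟩ := hFS.exp_norm
  have h := hFS.lie_commutator A A
  have h1 : ∀ t : ℝ, S.exp (t • A) * S.exp (t • A) * (S.exp (t • A))⁻¹ * (S.exp (t • A))⁻¹ = 1 := fun t => by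
    rw [mul_inv_cancel_right, mul_inv_cancel]
  simp_rw [h1] at h
  have hsmall : ∀ᶠ t : ℝ in 𝓝 0, ‖t ^ 2 • S.lie A A‖ < ρ := by
    have hc : Continuous fun t : ℝ => ‖t ^ 2 • S.lie A A‖ := by fun_prop
    have h0 : ‖(0 : ℝ) ^ 2 • S.lie A A‖ < ρ := by simpa using hρ
    exact hc.continuousAt.eventually (gt_mem_nhds h0)
  have hev : ∀ᶠ t : ℝ in 𝓝[≠] 0, (t ^ 2)⁻¹ * dist 1 (S.exp (t ^ 2 • S.lie A A)) = ‖S.lie A A‖ := by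
    filter_upwards [nhdsWithin_le_nhds hsmall, self_mem_nhdsWithin] with t ht ht0
    have ht0' : t ≠ 0 := ht0
    have habs : absG (S.exp (t ^ 2 • S.lie A A)) = ‖t ^ 2 • S.lie A A‖ := hnorm _ ht
    rw [absG_def] at habs
    rw [habs, norm_smul, Real.norm_eq_abs, abs_pow, sq_abs, ← mul_assoc, inv_mul_cancel₀ (pow_ne_zero 2 ht0'), one_mul]
  have hlim : Tendsto (fun _ : ℝ => ‖S.lie A A‖) (𝓝[≠] (0 : ℝ)) (𝓝 0) := h.congr' hev
  have hzero : ‖S.lie A A‖ = 0 := tendsto_nhds_unique tendsto_const_nhds hlim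
  exact norm_eq_zero.1 hzero

/-- `[−X, −Y] = [X, Y]` (bilinearity). [cite: Federbush1987PhaseCellIII, (1.8) p. 295] -/
theorem lie_neg_neg (X Y : S.𝔤) : S.lie (-X) (-Y) = S.lie X Y := by
  simp only [map_neg, LinearMap.neg_apply, neg_neg]

/-- The bracket is a bounded bilinear map (`𝔤` is finite-dimensional): `∃ L ≥ 0, |[X, Y]| ≤ L|X||Y|`.
[cite: Federbush1987PhaseCellVI, (5) p. 19, (20) p. 21] -/
theorem exists_lie_bound : ∃ L : ℝ, 0 ≤ L ∧ ∀ X Y : S.𝔤, ‖S.lie X Y‖ ≤ L * ‖X‖ * ‖Y‖ := by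
  let e : (S.𝔤 →ₗ[ℝ] S.𝔤) ≃ₗ[ℝ] (S.𝔤 →L[ℝ] S.𝔤) := LinearMap.toContinuousLinearMap
  let B : S.𝔤 →L[ℝ] (S.𝔤 →L[ℝ] S.𝔤) := LinearMap.toContinuousLinearMap (e.toLinearMap ∘ₗ S.lie)
  have hB : ∀ X Y, B X Y = S.lie X Y := fun X Y => by
    simp [B, e]
  refine ⟨‖B‖, norm_nonneg B, fun X Y => ?_⟩
  rw [← hB]
  calc ‖B X Y‖ ≤ ‖B X‖ * ‖Y‖ := (B X).le_opNorm Y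
    _ ≤ ‖B‖ * ‖X‖ * ‖Y‖ := by
        gcongr
        exact B.le_opNorm X

/-! ## §2 The plaquette word of four exponentials to second order -/

/-- `||g| − |h|| ≤ d(g, h)` for `|g| = d(Id, g)`. [cite: Federbush1987PhaseCellVI, (6) p. 19] -/
theorem abs_absG_sub_absG_le (g h : S.G) : |absG g - absG h| ≤ dist g h := by
  rw [absG_def, absG_def, dist_comm (1 : S.G) g, dist_comm (1 : S.G) h]
  exact abs_dist_sub_le g h 1

/-- The algebra of the three-fold BCH combination, for ANY bilinear bracket `B`: with `Y₁ = a₁ + a₂ + ½B(a₁,a₂)`,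
`Y₂ = −a₃ − a₄ + ½B(a₃,a₄)`, one has `Y₁ + Y₂ + ½B(Y₁,Y₂) = P + Q + R`, `P = a₁ + a₂ − a₃ − a₄`,
`Q = ½(B(a₁,a₂) + B(a₃,a₄) − B(a₁+a₂, a₃+a₄))`, `R = ¼B(a₁+a₂, B(a₃,a₄)) − ¼B(B(a₁,a₂), a₃+a₄) + ⅛B(B(a₁,a₂), B(a₃,a₄))`.
[cite: Federbush1987PhaseCellIII, (1.8)–(1.9) p. 295] -/
theorem bch_combine {V : Type*} [AddCommGroup V] [Module ℝ V] (B : V →ₗ[ℝ] V →ₗ[ℝ] V) (a₁ a₂ a₃ a₄ : V) :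
    (a₁ + a₂ + (1 / 2 : ℝ) • B a₁ a₂) + (-a₃ + -a₄ + (1 / 2 : ℝ) • B a₃ a₄) +
        (1 / 2 : ℝ) • B (a₁ + a₂ + (1 / 2 : ℝ) • B a₁ a₂) (-a₃ + -a₄ + (1 / 2 : ℝ) • B a₃ a₄) =
      (a₁ + a₂ - a₃ - a₄) + (1 / 2 : ℝ) • (B a₁ a₂ + B a₃ a₄ - B (a₁ + a₂) (a₃ + a₄)) +
        ((1 / 4 : ℝ) • B (a₁ + a₂) (B a₃ a₄) - (1 / 4 : ℝ) • B (B a₁ a₂) (a₃ + a₄) +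
          (1 / 8 : ℝ) • B (B a₁ a₂) (B a₃ a₄)) := by
  simp only [map_add, map_neg, map_smul, LinearMap.add_apply, LinearMap.smul_apply, smul_add, smul_neg, smul_sub,
    smul_smul]
  norm_num
  module

/-- Norm bound for a bracket from bounds on its arguments. [cite: Federbush1987PhaseCellVI, (20) p. 21] -/
theorem norm_lie_le_of_le {L : ℝ} (hL0 : 0 ≤ L) (hL : ∀ X Y : S.𝔤, ‖S.lie X Y‖ ≤ L * ‖X‖ * ‖Y‖)
    {X Y : S.𝔤} {u v : ℝ} (hX : ‖X‖ ≤ u) (hY : ‖Y‖ ≤ v) : ‖S.lie X Y‖ ≤ L * u * v := by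
  have hu : 0 ≤ u := (norm_nonneg X).trans hX
  calc ‖S.lie X Y‖ ≤ L * ‖X‖ * ‖Y‖ := hL X Y
    _ ≤ L * u * v := by
        apply mul_le_mul (mul_le_mul_of_nonneg_left hX hL0) hY (norm_nonneg Y) (mul_nonneg hL0 hu)

/-- The remainder `R` of `bch_combine` is cubic: if `|a₁+a₂|, |a₃+a₄| ≤ s`, `|B(a₁,a₂)|, |B(a₃,a₄)| ≤ L s²`, `L s ≤ 1`, then
`|R| ≤ L² s³`. [cite: Federbush1987PhaseCellIII, (1.5) p. 295] -/
theorem norm_bchRem_le {L s : ℝ} (hL0 : 0 ≤ L) (hL : ∀ X Y : S.𝔤, ‖S.lie X Y‖ ≤ L * ‖X‖ * ‖Y‖) (hs : 0 ≤ s)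
    (hLs : L * s ≤ 1) {a₁ a₂ a₃ a₄ : S.𝔤} (h12 : ‖a₁ + a₂‖ ≤ s) (h34 : ‖a₃ + a₄‖ ≤ s)
    (hb12 : ‖S.lie a₁ a₂‖ ≤ L * s * s) (hb34 : ‖S.lie a₃ a₄‖ ≤ L * s * s) :
    ‖(1 / 4 : ℝ) • S.lie (a₁ + a₂) (S.lie a₃ a₄) - (1 / 4 : ℝ) • S.lie (S.lie a₁ a₂) (a₃ + a₄) +
        (1 / 8 : ℝ) • S.lie (S.lie a₁ a₂) (S.lie a₃ a₄)‖ ≤ L ^ 2 * s ^ 3 := by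
  have t1 : ‖S.lie (a₁ + a₂) (S.lie a₃ a₄)‖ ≤ L * s * (L * s * s) := S.norm_lie_le_of_le hL0 hL h12 hb34
  have t2 : ‖S.lie (S.lie a₁ a₂) (a₃ + a₄)‖ ≤ L * (L * s * s) * s := S.norm_lie_le_of_le hL0 hL hb12 h34
  have t3 : ‖S.lie (S.lie a₁ a₂) (S.lie a₃ a₄)‖ ≤ L * (L * s * s) * (L * s * s) := S.norm_lie_le_of_le hL0 hL hb12 hb34
  have hq : ‖(1 / 4 : ℝ)‖ = 1 / 4 := by norm_num
  have he : ‖(1 / 8 : ℝ)‖ = 1 / 8 := by norm_num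
  have hL2s3 : 0 ≤ L ^ 2 * s ^ 3 := by positivity
  have hLs' : L * (L * s * s) * (L * s * s) ≤ L ^ 2 * s ^ 3 := by
    have : L * (L * s * s) * (L * s * s) = (L * s) * (L ^ 2 * s ^ 3) := by ring
    rw [this]
    calc (L * s) * (L ^ 2 * s ^ 3) ≤ 1 * (L ^ 2 * s ^ 3) := mul_le_mul_of_nonneg_right hLs hL2s3
      _ = L ^ 2 * s ^ 3 := one_mul _
  calc ‖(1 / 4 : ℝ) • S.lie (a₁ + a₂) (S.lie a₃ a₄) - (1 / 4 : ℝ) • S.lie (S.lie a₁ a₂) (a₃ + a₄) +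
          (1 / 8 : ℝ) • S.lie (S.lie a₁ a₂) (S.lie a₃ a₄)‖
      ≤ ‖(1 / 4 : ℝ) • S.lie (a₁ + a₂) (S.lie a₃ a₄)‖ + ‖(1 / 4 : ℝ) • S.lie (S.lie a₁ a₂) (a₃ + a₄)‖ +
          ‖(1 / 8 : ℝ) • S.lie (S.lie a₁ a₂) (S.lie a₃ a₄)‖ := norm_add_le_of_le (norm_sub_le _ _) le_rfl
    _ = (1 / 4) * ‖S.lie (a₁ + a₂) (S.lie a₃ a₄)‖ + (1 / 4) * ‖S.lie (S.lie a₁ a₂) (a₃ + a₄)‖ +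
          (1 / 8) * ‖S.lie (S.lie a₁ a₂) (S.lie a₃ a₄)‖ := by rw [norm_smul, norm_smul, norm_smul, hq, he]
    _ ≤ (1 / 4) * (L * s * (L * s * s)) + (1 / 4) * (L * (L * s * s) * s) + (1 / 8) * (L ^ 2 * s ^ 3) := by
          gcongr
          exact t3.trans hLs'
    _ = (5 / 8) * (L ^ 2 * s ^ 3) := by ring
    _ ≤ L ^ 2 * s ^ 3 := by linarith

/-- **The plaquette word to second order — core estimate** with the smallness conditions on `s = Σ|a_i|` explicit
(`L s ≤ 1`, `2s < ρ` the BCH radius, `4s < ρ₀` the radius of `|e^X| = |X|`, `s ≤ 1`) and a non-negative BCH constant `C₀`: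
`| |e^{a₁}e^{a₂}(e^{a₃})⁻¹(e^{a₄})⁻¹| − |P + Q| | ≤ (10C₀ + L²) s³`. [cite: Federbush1987PhaseCellVI, (5)–(6) p. 19, (10) p. 20;
Federbush1987PhaseCellIII, (1.6)–(1.9) p. 295] -/
theorem absG_plaqWord_expansion_core (hFS : S.IsFederbushSystem) {ρ₀ ρ C₀ L s : ℝ}
    (hnorm : Lemma10Normalisation S.exp ρ₀) (hC₀ : 0 ≤ C₀)
    (hC' : ∀ X Y : S.𝔤, ‖X‖ < ρ → ‖Y‖ < ρ →
      dist (S.exp X * S.exp Y) (S.exp (X + Y + (1 / 2 : ℝ) • S.lie X Y)) ≤ C₀ * (‖X‖ + ‖Y‖) ^ 3)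
    (hL0 : 0 ≤ L) (hL : ∀ X Y : S.𝔤, ‖S.lie X Y‖ ≤ L * ‖X‖ * ‖Y‖)
    (a₁ a₂ a₃ a₄ : S.𝔤) (hsdef : s = ‖a₁‖ + ‖a₂‖ + ‖a₃‖ + ‖a₄‖) (hLs : L * s ≤ 1) (hsρ : 2 * s < ρ)
    (hsρ₀ : 4 * s < ρ₀) :
    |absG (S.exp a₁ * S.exp a₂ * (S.exp a₃)⁻¹ * (S.exp a₄)⁻¹) -
        ‖a₁ + a₂ - a₃ - a₄ + (1 / 2 : ℝ) • (S.lie a₁ a₂ + S.lie a₃ a₄ - S.lie (a₁ + a₂) (a₃ + a₄))‖| ≤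
      (10 * C₀ + L ^ 2) * s ^ 3 := by
  have n₁ := norm_nonneg a₁
  have n₂ := norm_nonneg a₂
  have n₃ := norm_nonneg a₃
  have n₄ := norm_nonneg a₄
  have hs0 : 0 ≤ s := by rw [hsdef]; positivity
  have ha₁ : ‖a₁‖ ≤ s := by rw [hsdef]; linarith
  have ha₂ : ‖a₂‖ ≤ s := by rw [hsdef]; linarith
  have ha₃ : ‖a₃‖ ≤ s := by rw [hsdef]; linarith
  have ha₄ : ‖a₄‖ ≤ s := by rw [hsdef]; linarith
  have ha₁ρ : ‖a₁‖ < ρ := by linarith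
  have ha₂ρ : ‖a₂‖ < ρ := by linarith
  have ha₃ρ : ‖-a₃‖ < ρ := by rw [norm_neg]; linarith
  have ha₄ρ : ‖-a₄‖ < ρ := by rw [norm_neg]; linarith
  have h12 : ‖a₁ + a₂‖ ≤ s := (norm_add_le _ _).trans (by rw [hsdef]; linarith)
  have h34 : ‖a₃ + a₄‖ ≤ s := (norm_add_le _ _).trans (by rw [hsdef]; linarith)
  have hLss : L * s * s ≤ s := by
    calc L * s * s ≤ 1 * s := mul_le_mul_of_nonneg_right hLs hs0
      _ = s := one_mul s
  have hb12 : ‖S.lie a₁ a₂‖ ≤ L * s * s := S.norm_lie_le_of_le hL0 hL ha₁ ha₂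
  have hb34 : ‖S.lie a₃ a₄‖ ≤ L * s * s := S.norm_lie_le_of_le hL0 hL ha₃ ha₄
  have hhalf : ‖(1 / 2 : ℝ)‖ = 1 / 2 := by norm_num
  -- the intermediate elements `Y₁`, `Y₂` and their sizes
  have hY₁n : ‖a₁ + a₂ + (1 / 2 : ℝ) • S.lie a₁ a₂‖ ≤ ‖a₁‖ + ‖a₂‖ + (1 / 2) * (L * s * s) := by
    calc ‖a₁ + a₂ + (1 / 2 : ℝ) • S.lie a₁ a₂‖ ≤ ‖a₁ + a₂‖ + ‖(1 / 2 : ℝ) • S.lie a₁ a₂‖ := norm_add_le _ _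
      _ = ‖a₁ + a₂‖ + (1 / 2) * ‖S.lie a₁ a₂‖ := by rw [norm_smul, hhalf]
      _ ≤ (‖a₁‖ + ‖a₂‖) + (1 / 2) * (L * s * s) := add_le_add (norm_add_le _ _) (by gcongr)
  have hY₂n : ‖-a₃ + -a₄ + (1 / 2 : ℝ) • S.lie (-a₃) (-a₄)‖ ≤ ‖a₃‖ + ‖a₄‖ + (1 / 2) * (L * s * s) := by
    rw [S.lie_neg_neg]
    calc ‖-a₃ + -a₄ + (1 / 2 : ℝ) • S.lie a₃ a₄‖ ≤ ‖-a₃ + -a₄‖ + ‖(1 / 2 : ℝ) • S.lie a₃ a₄‖ := norm_add_le _ _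
      _ = ‖-a₃ + -a₄‖ + (1 / 2) * ‖S.lie a₃ a₄‖ := by rw [norm_smul, hhalf]
      _ ≤ (‖a₃‖ + ‖a₄‖) + (1 / 2) * (L * s * s) :=
          add_le_add ((norm_add_le _ _).trans (by rw [norm_neg, norm_neg])) (by gcongr)
  have hYsum : ‖a₁ + a₂ + (1 / 2 : ℝ) • S.lie a₁ a₂‖ + ‖-a₃ + -a₄ + (1 / 2 : ℝ) • S.lie (-a₃) (-a₄)‖ ≤ 2 * s := by
    have : ‖a₁‖ + ‖a₂‖ + (1 / 2) * (L * s * s) + (‖a₃‖ + ‖a₄‖ + (1 / 2) * (L * s * s)) = s + L * s * s := by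
      rw [hsdef]; ring
    linarith [add_le_add hY₁n hY₂n]
  have hY₁ρ : ‖a₁ + a₂ + (1 / 2 : ℝ) • S.lie a₁ a₂‖ < ρ := by linarith [norm_nonneg (-a₃ + -a₄ + (1 / 2 : ℝ) • S.lie (-a₃) (-a₄))]
  have hY₂ρ : ‖-a₃ + -a₄ + (1 / 2 : ℝ) • S.lie (-a₃) (-a₄)‖ < ρ := by linarith [norm_nonneg (a₁ + a₂ + (1 / 2 : ℝ) • S.lie a₁ a₂)]
  -- Steps 1–2: BCH on the two halves and their product
  have hd12 : dist (S.exp a₁ * S.exp a₂ * (S.exp a₃)⁻¹ * (S.exp a₄)⁻¹)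
      (S.exp (a₁ + a₂ + (1 / 2 : ℝ) • S.lie a₁ a₂) * S.exp (-a₃ + -a₄ + (1 / 2 : ℝ) • S.lie (-a₃) (-a₄))) ≤
      C₀ * (‖a₁‖ + ‖a₂‖) ^ 3 + C₀ * (‖-a₃‖ + ‖-a₄‖) ^ 3 := by
    rw [S.plaqWord_eq hFS]
    exact (S.dist_mul_mul_le _ _ _ _).trans (add_le_add (hC' a₁ a₂ ha₁ρ ha₂ρ) (hC' (-a₃) (-a₄) ha₃ρ ha₄ρ))
  -- Step 3: BCH once more
  have hd3 := hC' _ _ hY₁ρ hY₂ρ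
  -- the combined element `Z` and its algebra
  have hZeq := bch_combine S.lie a₁ a₂ a₃ a₄
  -- sizes of `P`, `Q`, `R`
  have hRn : ‖(1 / 4 : ℝ) • S.lie (a₁ + a₂) (S.lie a₃ a₄) - (1 / 4 : ℝ) • S.lie (S.lie a₁ a₂) (a₃ + a₄) +
      (1 / 8 : ℝ) • S.lie (S.lie a₁ a₂) (S.lie a₃ a₄)‖ ≤ L ^ 2 * s ^ 3 :=
    S.norm_bchRem_le hL0 hL hs0 hLs h12 h34 hb12 hb34
  have hL2s : L ^ 2 * s ^ 3 ≤ s := by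
    have : L ^ 2 * s ^ 3 = (L * s) * (L * s * s) := by ring
    rw [this]
    calc (L * s) * (L * s * s) ≤ 1 * s := mul_le_mul hLs hLss (by positivity) zero_le_one
      _ = s := one_mul s
  have hPn : ‖a₁ + a₂ - a₃ - a₄‖ ≤ s := by
    calc ‖a₁ + a₂ - a₃ - a₄‖ = ‖(a₁ + a₂) - (a₃ + a₄)‖ := by rw [sub_sub]
      _ ≤ ‖a₁ + a₂‖ + ‖a₃ + a₄‖ := norm_sub_le _ _
      _ ≤ ‖a₁‖ + ‖a₂‖ + (‖a₃‖ + ‖a₄‖) := add_le_add (norm_add_le _ _) (norm_add_le _ _)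
      _ = s := by rw [hsdef]; ring
  have hQn : ‖(1 / 2 : ℝ) • (S.lie a₁ a₂ + S.lie a₃ a₄ - S.lie (a₁ + a₂) (a₃ + a₄))‖ ≤ 2 * s := by
    have t : ‖S.lie (a₁ + a₂) (a₃ + a₄)‖ ≤ L * s * s := S.norm_lie_le_of_le hL0 hL h12 h34
    rw [norm_smul, hhalf]
    calc (1 / 2) * ‖S.lie a₁ a₂ + S.lie a₃ a₄ - S.lie (a₁ + a₂) (a₃ + a₄)‖
        ≤ (1 / 2) * (‖S.lie a₁ a₂‖ + ‖S.lie a₃ a₄‖ + ‖S.lie (a₁ + a₂) (a₃ + a₄)‖) := by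
          gcongr
          exact norm_sub_le_of_le (norm_add_le _ _) le_rfl
      _ ≤ (1 / 2) * (L * s * s + L * s * s + L * s * s) := by gcongr
      _ ≤ 2 * s := by linarith
  have hZn : ‖a₁ + a₂ + (1 / 2 : ℝ) • S.lie a₁ a₂ + (-a₃ + -a₄ + (1 / 2 : ℝ) • S.lie (-a₃) (-a₄)) +
      (1 / 2 : ℝ) • S.lie (a₁ + a₂ + (1 / 2 : ℝ) • S.lie a₁ a₂) (-a₃ + -a₄ + (1 / 2 : ℝ) • S.lie (-a₃) (-a₄))‖ < ρ₀ := by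
    rw [S.lie_neg_neg, hZeq]
    have : ‖a₁ + a₂ - a₃ - a₄ + (1 / 2 : ℝ) • (S.lie a₁ a₂ + S.lie a₃ a₄ - S.lie (a₁ + a₂) (a₃ + a₄)) +
        ((1 / 4 : ℝ) • S.lie (a₁ + a₂) (S.lie a₃ a₄) - (1 / 4 : ℝ) • S.lie (S.lie a₁ a₂) (a₃ + a₄) +
          (1 / 8 : ℝ) • S.lie (S.lie a₁ a₂) (S.lie a₃ a₄))‖ ≤ s + 2 * s + s :=
      norm_add₃_le.trans (add_le_add (add_le_add hPn hQn) (hRn.trans hL2s))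
    linarith
  have hdistZ := hnorm _ hZn
  rw [absG_def] at hdistZ
  -- Step 4: the distance from the word to `e^Z`
  have hA : C₀ * (‖a₁‖ + ‖a₂‖) ^ 3 ≤ C₀ * s ^ 3 := by
    gcongr; rw [hsdef]; linarith
  have hB : C₀ * (‖-a₃‖ + ‖-a₄‖) ^ 3 ≤ C₀ * s ^ 3 := by
    gcongr; rw [norm_neg, norm_neg, hsdef]; linarith
  have hY : C₀ * (‖a₁ + a₂ + (1 / 2 : ℝ) • S.lie a₁ a₂‖ + ‖-a₃ + -a₄ + (1 / 2 : ℝ) • S.lie (-a₃) (-a₄)‖) ^ 3 ≤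
      C₀ * (2 * s) ^ 3 := by gcongr
  have h8 : C₀ * (2 * s) ^ 3 = 8 * (C₀ * s ^ 3) := by ring
  have hdZ : dist (S.exp a₁ * S.exp a₂ * (S.exp a₃)⁻¹ * (S.exp a₄)⁻¹)
      (S.exp (a₁ + a₂ + (1 / 2 : ℝ) • S.lie a₁ a₂ + (-a₃ + -a₄ + (1 / 2 : ℝ) • S.lie (-a₃) (-a₄)) +
        (1 / 2 : ℝ) • S.lie (a₁ + a₂ + (1 / 2 : ℝ) • S.lie a₁ a₂) (-a₃ + -a₄ + (1 / 2 : ℝ) • S.lie (-a₃) (-a₄)))) ≤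
      10 * C₀ * s ^ 3 := by
    refine (dist_triangle _ _ _).trans ((add_le_add hd12 hd3).trans ?_)
    rw [h8] at hY
    linarith
  -- Step 5: assemble
  have e1 := (S.abs_absG_sub_absG_le (S.exp a₁ * S.exp a₂ * (S.exp a₃)⁻¹ * (S.exp a₄)⁻¹) _).trans hdZ
  rw [absG_def (S.exp _), hdistZ, S.lie_neg_neg, hZeq] at e1
  have e2 : |‖a₁ + a₂ - a₃ - a₄ + (1 / 2 : ℝ) • (S.lie a₁ a₂ + S.lie a₃ a₄ - S.lie (a₁ + a₂) (a₃ + a₄)) +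
      ((1 / 4 : ℝ) • S.lie (a₁ + a₂) (S.lie a₃ a₄) - (1 / 4 : ℝ) • S.lie (S.lie a₁ a₂) (a₃ + a₄) +
        (1 / 8 : ℝ) • S.lie (S.lie a₁ a₂) (S.lie a₃ a₄))‖ -
      ‖a₁ + a₂ - a₃ - a₄ + (1 / 2 : ℝ) • (S.lie a₁ a₂ + S.lie a₃ a₄ - S.lie (a₁ + a₂) (a₃ + a₄))‖| ≤ L ^ 2 * s ^ 3 :=
    (abs_norm_sub_norm_le _ _).trans (by rw [add_sub_cancel_left]; exact hRn)
  have h3 := (abs_sub_le _ _ _).trans (add_le_add e1 e2)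
  have : 10 * C₀ * s ^ 3 + L ^ 2 * s ^ 3 = (10 * C₀ + L ^ 2) * s ^ 3 := by ring
  rw [this] at h3
  exact h3

/-- **The plaquette word to second order (BCH).**  Under the scheme `hFS` and the uniform BCH binder `hBCH` of T-F6-2 there
are `ρ₁ > 0` and `K ≥ 0` such that for all `a₁, a₂, a₃, a₄` with `|a_i| < ρ₁`:
`| |e^{a₁}e^{a₂}(e^{a₃})⁻¹(e^{a₄})⁻¹| − |a₁ + a₂ − a₃ − a₄ + ½([a₁,a₂] + [a₃,a₄] − [a₁+a₂, a₃+a₄])| | ≤ K (|a₁|+|a₂|+|a₃|+|a₄|)³`.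
[cite: Federbush1987PhaseCellVI, (5)–(6) p. 19, (10) p. 20, Theorem 2 p. 20; Federbush1987PhaseCellIII, (1.6)–(1.9) p. 295] -/
theorem absG_plaqWord_expansion (hFS : S.IsFederbushSystem)
    (hBCH : ∃ ρ > (0 : ℝ), ∃ C : ℝ, ∀ X Y : S.𝔤, ‖X‖ < ρ → ‖Y‖ < ρ →
      dist (S.exp X * S.exp Y) (S.exp (X + Y + (1 / 2 : ℝ) • S.lie X Y)) ≤ C * (‖X‖ + ‖Y‖) ^ 3) :
    ∃ ρ₁ > (0 : ℝ), ∃ K : ℝ, 0 ≤ K ∧ ∀ a₁ a₂ a₃ a₄ : S.𝔤, ‖a₁‖ < ρ₁ → ‖a₂‖ < ρ₁ → ‖a₃‖ < ρ₁ → ‖a₄‖ < ρ₁ →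
      |absG (S.exp a₁ * S.exp a₂ * (S.exp a₃)⁻¹ * (S.exp a₄)⁻¹) -
          ‖a₁ + a₂ - a₃ - a₄ + (1 / 2 : ℝ) • (S.lie a₁ a₂ + S.lie a₃ a₄ - S.lie (a₁ + a₂) (a₃ + a₄))‖| ≤
        K * (‖a₁‖ + ‖a₂‖ + ‖a₃‖ + ‖a₄‖) ^ 3 := by
  obtain ⟨ρ₀, hρ₀, hnorm⟩ := hFS.exp_norm
  obtain ⟨ρ, hρ, C, hC⟩ := hBCH
  obtain ⟨L, hL0, hL⟩ := S.exists_lie_bound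
  -- we may take `C ≥ 0`
  have hC' : ∀ X Y : S.𝔤, ‖X‖ < ρ → ‖Y‖ < ρ →
      dist (S.exp X * S.exp Y) (S.exp (X + Y + (1 / 2 : ℝ) • S.lie X Y)) ≤ max C 0 * (‖X‖ + ‖Y‖) ^ 3 :=
    fun X Y hX hY => (hC X Y hX hY).trans (mul_le_mul_of_nonneg_right (le_max_left _ _) (by positivity))
  have hLp : 0 < L + 1 := by linarith
  have hr : 0 < 1 / (4 * (L + 1)) := by positivity
  refine ⟨min (1 / (4 * (L + 1))) (min (ρ / 8) (ρ₀ / 16)), lt_min hr (lt_min (by linarith) (by linarith)),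
    10 * max C 0 + L ^ 2, by positivity, ?_⟩
  intro a₁ a₂ a₃ a₄ h₁ h₂ h₃ h₄
  have hρ₁b : min (1 / (4 * (L + 1))) (min (ρ / 8) (ρ₀ / 16)) ≤ 1 / (4 * (L + 1)) := min_le_left _ _
  have hρ₁c : min (1 / (4 * (L + 1))) (min (ρ / 8) (ρ₀ / 16)) ≤ ρ / 8 := (min_le_right _ _).trans (min_le_left _ _)
  have hρ₁d : min (1 / (4 * (L + 1))) (min (ρ / 8) (ρ₀ / 16)) ≤ ρ₀ / 16 := (min_le_right _ _).trans (min_le_right _ _)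
  refine S.absG_plaqWord_expansion_core hFS hnorm (le_max_right _ _) hC' hL0 hL a₁ a₂ a₃ a₄ rfl ?_ ?_ ?_
  · have hs' : ‖a₁‖ + ‖a₂‖ + ‖a₃‖ + ‖a₄‖ ≤ 4 * (1 / (4 * (L + 1))) := by linarith
    have h4 : 4 * (1 / (4 * (L + 1))) = 1 / (L + 1) := by field_simp
    rw [h4] at hs'
    calc L * (‖a₁‖ + ‖a₂‖ + ‖a₃‖ + ‖a₄‖) ≤ L * (1 / (L + 1)) := mul_le_mul_of_nonneg_left hs' hL0
      _ ≤ (L + 1) * (1 / (L + 1)) := mul_le_mul_of_nonneg_right (by linarith) (by positivity)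
      _ = 1 := mul_one_div_cancel hLp.ne'
  · linarith
  · linarith

/-! ## §3 The lattice specialisation: `a_i = ℓ α_i + δ_i`, `α = (U, V, U, V)` -/

/-- The commutator term on an affine plaquette configuration, for ANY bilinear bracket `B`: with `a₁ = ℓU + δ₁`, `a₂ = ℓV + δ₂`,
`a₃ = ℓU + δ₃`, `a₄ = ℓV + δ₄`,
`½(B(a₁,a₂) + B(a₃,a₄) − B(a₁+a₂, a₃+a₄)) − ℓ²B(U,V) = ½(ℓ·(cross terms) + (δδ terms)) − ½ℓ²B(U+V, U+V)`.
[cite: Federbush1987PhaseCellIII, (1.8)–(1.9) p. 295] -/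
theorem commutatorTerm_affine_eq {V : Type*} [AddCommGroup V] [Module ℝ V] (B : V →ₗ[ℝ] V →ₗ[ℝ] V) (ℓ : ℝ)
    (U W δ₁ δ₂ δ₃ δ₄ : V) :
    (1 / 2 : ℝ) • (B (ℓ • U + δ₁) (ℓ • W + δ₂) + B (ℓ • U + δ₃) (ℓ • W + δ₄) -
          B (ℓ • U + δ₁ + (ℓ • W + δ₂)) (ℓ • U + δ₃ + (ℓ • W + δ₄))) - ℓ ^ 2 • B U W =
      (1 / 2 : ℝ) • (ℓ • (B U δ₂ + B δ₁ W + B U δ₄ + B δ₃ W - B (U + W) (δ₃ + δ₄) - B (δ₁ + δ₂) (U + W)) +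
          (B δ₁ δ₂ + B δ₃ δ₄ - B (δ₁ + δ₂) (δ₃ + δ₄))) - ((1 / 2 : ℝ) * ℓ ^ 2) • B (U + W) (U + W) := by
  simp only [map_add, map_smul, LinearMap.add_apply, LinearMap.smul_apply, smul_add, smul_sub, smul_smul]
  module

/-- **The commutator term is `ℓ²[U,V] + O(ℓ³)`** on an affine plaquette configuration (`|U|, |V| ≤ B`, `|δ_i| ≤ Dℓ²`,
`0 ≤ ℓ ≤ 1`), using `[X, X] = 0` (`lie_self`): `|Q − ℓ²[U,V]| ≤ L(6BD + 3D²)ℓ³`.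
[cite: Federbush1987PhaseCellVI, p. 18 («A ∧ A»), Theorem 2 p. 20; Federbush1987PhaseCellIII, (1.8)–(1.9) p. 295] -/
theorem norm_commutatorTerm_affine_sub_le (hFS : S.IsFederbushSystem) {L : ℝ} (hL0 : 0 ≤ L)
    (hL : ∀ X Y : S.𝔤, ‖S.lie X Y‖ ≤ L * ‖X‖ * ‖Y‖) {ℓ B D : ℝ} (hℓ : 0 ≤ ℓ) (hℓ1 : ℓ ≤ 1) (hB : 0 ≤ B) (hD : 0 ≤ D)
    {U W δ₁ δ₂ δ₃ δ₄ : S.𝔤} (hU : ‖U‖ ≤ B) (hW : ‖W‖ ≤ B) (hδ₁ : ‖δ₁‖ ≤ D * ℓ ^ 2) (hδ₂ : ‖δ₂‖ ≤ D * ℓ ^ 2)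
    (hδ₃ : ‖δ₃‖ ≤ D * ℓ ^ 2) (hδ₄ : ‖δ₄‖ ≤ D * ℓ ^ 2) :
    ‖(1 / 2 : ℝ) • (S.lie (ℓ • U + δ₁) (ℓ • W + δ₂) + S.lie (ℓ • U + δ₃) (ℓ • W + δ₄) -
          S.lie (ℓ • U + δ₁ + (ℓ • W + δ₂)) (ℓ • U + δ₃ + (ℓ • W + δ₄))) - ℓ ^ 2 • S.lie U W‖ ≤
      L * (6 * B * D + 3 * D ^ 2) * ℓ ^ 3 := by
  rw [commutatorTerm_affine_eq S.lie, S.lie_self hFS (U + W), smul_zero, sub_zero, norm_smul,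
    show ‖(1 / 2 : ℝ)‖ = 1 / 2 by norm_num]
  have hUW : ‖U + W‖ ≤ 2 * B := (norm_add_le _ _).trans (by linarith)
  have hδ12 : ‖δ₁ + δ₂‖ ≤ 2 * (D * ℓ ^ 2) := (norm_add_le _ _).trans (by linarith)
  have hδ34 : ‖δ₃ + δ₄‖ ≤ 2 * (D * ℓ ^ 2) := (norm_add_le _ _).trans (by linarith)
  have c1 := S.norm_lie_le_of_le hL0 hL hU hδ₂
  have c2 := S.norm_lie_le_of_le hL0 hL hδ₁ hW
  have c3 := S.norm_lie_le_of_le hL0 hL hU hδ₄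
  have c4 := S.norm_lie_le_of_le hL0 hL hδ₃ hW
  have c5 := S.norm_lie_le_of_le hL0 hL hUW hδ34
  have c6 := S.norm_lie_le_of_le hL0 hL hδ12 hUW
  have d1 := S.norm_lie_le_of_le hL0 hL hδ₁ hδ₂
  have d2 := S.norm_lie_le_of_le hL0 hL hδ₃ hδ₄
  have d3 := S.norm_lie_le_of_le hL0 hL hδ12 hδ34
  have hcross : ‖S.lie U δ₂ + S.lie δ₁ W + S.lie U δ₄ + S.lie δ₃ W - S.lie (U + W) (δ₃ + δ₄) -
      S.lie (δ₁ + δ₂) (U + W)‖ ≤ 12 * (L * B * (D * ℓ ^ 2)) := by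
    have := norm_sub_le_of_le (norm_sub_le_of_le (norm_add_le_of_le (norm_add_le_of_le (norm_add_le_of_le c1 c2) c3)
      c4) c5) c6
    refine this.trans ?_
    have e1 : L * (D * ℓ ^ 2) * B = L * B * (D * ℓ ^ 2) := by ring
    have e2 : L * (2 * B) * (2 * (D * ℓ ^ 2)) = 4 * (L * B * (D * ℓ ^ 2)) := by ring
    have e3 : L * (2 * (D * ℓ ^ 2)) * (2 * B) = 4 * (L * B * (D * ℓ ^ 2)) := by ring
    rw [e1, e2, e3]
    linarith
  have hdd : ‖S.lie δ₁ δ₂ + S.lie δ₃ δ₄ - S.lie (δ₁ + δ₂) (δ₃ + δ₄)‖ ≤ 6 * (L * (D * ℓ ^ 2) * (D * ℓ ^ 2)) := by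
    have := norm_sub_le_of_le (norm_add_le_of_le d1 d2) d3
    refine this.trans ?_
    have e : L * (2 * (D * ℓ ^ 2)) * (2 * (D * ℓ ^ 2)) = 4 * (L * (D * ℓ ^ 2) * (D * ℓ ^ 2)) := by ring
    rw [e]
    linarith
  have hℓ3 : ℓ ^ 4 ≤ ℓ ^ 3 := pow_le_pow_of_le_one hℓ hℓ1 (by norm_num)
  have hLBD : 0 ≤ L * B * D := by positivity
  have hLDD : 0 ≤ L * D * D := by positivity
  calc (1 / 2) * ‖ℓ • (S.lie U δ₂ + S.lie δ₁ W + S.lie U δ₄ + S.lie δ₃ W - S.lie (U + W) (δ₃ + δ₄) -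
          S.lie (δ₁ + δ₂) (U + W)) + (S.lie δ₁ δ₂ + S.lie δ₃ δ₄ - S.lie (δ₁ + δ₂) (δ₃ + δ₄))‖
      ≤ (1 / 2) * (ℓ * (12 * (L * B * (D * ℓ ^ 2))) + 6 * (L * (D * ℓ ^ 2) * (D * ℓ ^ 2))) := by
        gcongr
        refine norm_add_le_of_le ?_ hdd
        rw [norm_smul, Real.norm_of_nonneg hℓ]
        exact mul_le_mul_of_nonneg_left hcross hℓ
    _ = 6 * (L * B * D) * ℓ ^ 3 + 3 * (L * D * D) * ℓ ^ 4 := by ring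
    _ ≤ 6 * (L * B * D) * ℓ ^ 3 + 3 * (L * D * D) * ℓ ^ 3 := by gcongr
    _ = L * (6 * B * D + 3 * D ^ 2) * ℓ ^ 3 := by ring

/-- **The plaquette word on an affine configuration: `|g_{∂p}| = |P + ℓ²[U,V]| + O(ℓ³)`.**  Under `hFS` and the BCH binder of
T-F6-2 there are `ρ₁ > 0`, `K ≥ 0`, `L ≥ 0` such that for every side `0 ≤ ℓ ≤ 1`, bounds `B, D ≥ 0` with `4ℓ(B + D) < ρ₁`,
`|U|, |V| ≤ B` and corrections `|δ_i| ≤ Dℓ²`, the configuration `a₁ = ℓU + δ₁, a₂ = ℓV + δ₂, a₃ = ℓU + δ₃, a₄ = ℓV + δ₄`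
satisfies `| |e^{a₁}e^{a₂}(e^{a₃})⁻¹(e^{a₄})⁻¹| − |a₁ + a₂ − a₃ − a₄ + ℓ²[U,V]| | ≤ (64K(B+D)³ + L(6BD + 3D²))ℓ³` — the
commutator `[A_μ(x), A_ν(x)]` of `contActionDensity` emerges from the plaquette holonomy.
[cite: Federbush1987PhaseCellVI, p. 18, (10) p. 20, Theorem 2 p. 20; Federbush1987PhaseCellIII, (1.4)–(1.9) p. 295] -/
theorem absG_plaqWord_expansion_affine (hFS : S.IsFederbushSystem)
    (hBCH : ∃ ρ > (0 : ℝ), ∃ C : ℝ, ∀ X Y : S.𝔤, ‖X‖ < ρ → ‖Y‖ < ρ →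
      dist (S.exp X * S.exp Y) (S.exp (X + Y + (1 / 2 : ℝ) • S.lie X Y)) ≤ C * (‖X‖ + ‖Y‖) ^ 3) :
    ∃ ρ₁ > (0 : ℝ), ∃ K : ℝ, 0 ≤ K ∧ ∃ L : ℝ, 0 ≤ L ∧
      ∀ (ℓ B D : ℝ) (U W δ₁ δ₂ δ₃ δ₄ : S.𝔤), 0 ≤ ℓ → ℓ ≤ 1 → 0 ≤ B → 0 ≤ D → 4 * (ℓ * (B + D)) < ρ₁ →
        ‖U‖ ≤ B → ‖W‖ ≤ B → ‖δ₁‖ ≤ D * ℓ ^ 2 → ‖δ₂‖ ≤ D * ℓ ^ 2 → ‖δ₃‖ ≤ D * ℓ ^ 2 → ‖δ₄‖ ≤ D * ℓ ^ 2 →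
          |absG (S.exp (ℓ • U + δ₁) * S.exp (ℓ • W + δ₂) * (S.exp (ℓ • U + δ₃))⁻¹ * (S.exp (ℓ • W + δ₄))⁻¹) -
              ‖ℓ • U + δ₁ + (ℓ • W + δ₂) - (ℓ • U + δ₃) - (ℓ • W + δ₄) + ℓ ^ 2 • S.lie U W‖| ≤
            (64 * K * (B + D) ^ 3 + L * (6 * B * D + 3 * D ^ 2)) * ℓ ^ 3 := by
  obtain ⟨ρ₁, hρ₁, K, hK, hexp⟩ := S.absG_plaqWord_expansion hFS hBCH
  obtain ⟨L, hL0, hL⟩ := S.exists_lie_bound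
  refine ⟨ρ₁, hρ₁, K, hK, L, hL0, ?_⟩
  intro ℓ B D U W δ₁ δ₂ δ₃ δ₄ hℓ hℓ1 hB hD hsmall hU hW hδ₁ hδ₂ hδ₃ hδ₄
  -- every `a_i` has size `≤ ℓ(B + D) < ρ₁`
  have hℓ2 : ℓ ^ 2 ≤ ℓ := by nlinarith
  have hai : ∀ (X δ : S.𝔤), ‖X‖ ≤ B → ‖δ‖ ≤ D * ℓ ^ 2 → ‖ℓ • X + δ‖ ≤ ℓ * (B + D) := by
    intro X δ hX hδ
    calc ‖ℓ • X + δ‖ ≤ ‖ℓ • X‖ + ‖δ‖ := norm_add_le _ _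
      _ ≤ ℓ * B + D * ℓ ^ 2 := by rw [norm_smul, Real.norm_of_nonneg hℓ]; gcongr
      _ ≤ ℓ * B + D * ℓ := by gcongr
      _ = ℓ * (B + D) := by ring
  have hBD : 0 ≤ ℓ * (B + D) := by positivity
  have hlt : ℓ * (B + D) < ρ₁ := by linarith
  have h₁ := hai U δ₁ hU hδ₁
  have h₂ := hai W δ₂ hW hδ₂
  have h₃ := hai U δ₃ hU hδ₃
  have h₄ := hai W δ₄ hW hδ₄
  have hmain := hexp (ℓ • U + δ₁) (ℓ • W + δ₂) (ℓ • U + δ₃) (ℓ • W + δ₄) (h₁.trans_lt hlt) (h₂.trans_lt hlt)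
    (h₃.trans_lt hlt) (h₄.trans_lt hlt)
  have hQ := S.norm_commutatorTerm_affine_sub_le hFS hL0 hL hℓ hℓ1 hB hD hU hW hδ₁ hδ₂ hδ₃ hδ₄
  -- `s³ ≤ 64 ℓ³ (B+D)³`
  have hs : ‖ℓ • U + δ₁‖ + ‖ℓ • W + δ₂‖ + ‖ℓ • U + δ₃‖ + ‖ℓ • W + δ₄‖ ≤ 4 * (ℓ * (B + D)) := by linarith
  have hs3 : K * (‖ℓ • U + δ₁‖ + ‖ℓ • W + δ₂‖ + ‖ℓ • U + δ₃‖ + ‖ℓ • W + δ₄‖) ^ 3 ≤ 64 * K * (B + D) ^ 3 * ℓ ^ 3 := by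
    have : K * (‖ℓ • U + δ₁‖ + ‖ℓ • W + δ₂‖ + ‖ℓ • U + δ₃‖ + ‖ℓ • W + δ₄‖) ^ 3 ≤ K * (4 * (ℓ * (B + D))) ^ 3 := by
      gcongr
    refine this.trans (le_of_eq ?_)
    ring
  -- triangle: replace `Q` by `ℓ²[U,V]`
  have htri : |‖ℓ • U + δ₁ + (ℓ • W + δ₂) - (ℓ • U + δ₃) - (ℓ • W + δ₄) +
        (1 / 2 : ℝ) • (S.lie (ℓ • U + δ₁) (ℓ • W + δ₂) + S.lie (ℓ • U + δ₃) (ℓ • W + δ₄) -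
          S.lie (ℓ • U + δ₁ + (ℓ • W + δ₂)) (ℓ • U + δ₃ + (ℓ • W + δ₄)))‖ -
      ‖ℓ • U + δ₁ + (ℓ • W + δ₂) - (ℓ • U + δ₃) - (ℓ • W + δ₄) + ℓ ^ 2 • S.lie U W‖| ≤
      L * (6 * B * D + 3 * D ^ 2) * ℓ ^ 3 := by
    refine (abs_norm_sub_norm_le _ _).trans ?_
    rwa [add_sub_add_left_eq_sub]
  calc _ ≤ |absG (S.exp (ℓ • U + δ₁) * S.exp (ℓ • W + δ₂) * (S.exp (ℓ • U + δ₃))⁻¹ * (S.exp (ℓ • W + δ₄))⁻¹) -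
          ‖ℓ • U + δ₁ + (ℓ • W + δ₂) - (ℓ • U + δ₃) - (ℓ • W + δ₄) +
            (1 / 2 : ℝ) • (S.lie (ℓ • U + δ₁) (ℓ • W + δ₂) + S.lie (ℓ • U + δ₃) (ℓ • W + δ₄) -
              S.lie (ℓ • U + δ₁ + (ℓ • W + δ₂)) (ℓ • U + δ₃ + (ℓ • W + δ₄)))‖| +
        |‖ℓ • U + δ₁ + (ℓ • W + δ₂) - (ℓ • U + δ₃) - (ℓ • W + δ₄) +
            (1 / 2 : ℝ) • (S.lie (ℓ • U + δ₁) (ℓ • W + δ₂) + S.lie (ℓ • U + δ₃) (ℓ • W + δ₄) -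
              S.lie (ℓ • U + δ₁ + (ℓ • W + δ₂)) (ℓ • U + δ₃ + (ℓ • W + δ₄)))‖ -
          ‖ℓ • U + δ₁ + (ℓ • W + δ₂) - (ℓ • U + δ₃) - (ℓ • W + δ₄) + ℓ ^ 2 • S.lie U W‖| := abs_sub_le _ _ _
    _ ≤ 64 * K * (B + D) ^ 3 * ℓ ^ 3 + L * (6 * B * D + 3 * D ^ 2) * ℓ ^ 3 := add_le_add (hmain.trans hs3) htri
    _ = (64 * K * (B + D) ^ 3 + L * (6 * B * D + 3 * D ^ 2)) * ℓ ^ 3 := by ring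

end BlockSpinSystem

end

end Literature.MathematicalPhysics.QuantumFieldTheory.Federbush1986
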